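import Summits.QuantumFields.YangMills.Theorems.EquipartitionCriticalityFreeEnergyLogCoefficientAbstractA
import HarnessLib

/-!
# The abstract joint limit, upper bound (Lemma 17.4) — crux `FreeEnergyLogCoefficient`, line `Sketch`, stub `abstractJointLimit` (part B)

S. Chatterjee, *The leading term of the Yang–Mills free energy*, J. Funct. Anal. 271 (2016),
arXiv:1602.01222, §17, GROUP-FREE, for an abstract one-box interface `B : OneBoxBounds d` (port of
the first half of the tree file
`Literature/MathematicalPhysics/QuantumFieldTheory/ChatterjeeFreeEnergyJointLimit.lean`):

* `tendsto_Sbar`, `rho0_le_half_r₁`, `errU_sq_le`: along `m ≤ β^a` the Theorem-10.1 radius `ρ₀`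
  is eventually `≤ r₁/2` and the cubic error `Aβ(2ρ₀)³d²` of Lemma 17.2 tends to `0`;
* `T_le_T_add` (Lemma 17.3 ⇒ comparison of the normalised free energies) and `eventually_T_le`
  (**Lemma 17.4**): if `G(n) → A₀` then eventually, jointly in `(n, β)`, `T(B_n, β) ≤ A₀ + ε`.

## References

* S. Chatterjee, *The leading term of the Yang–Mills free energy*, J. Funct. Anal. 271 (2016)
  2944–3005, arXiv:1602.01222, §17 (Lemmas 17.2–17.4). [arXiv160201222]
-/

noncomputable section

open scoped Matrix Matrix.Norms.Frobenius ENNReal NNReal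
open MeasureTheory Measure Filter Topology Set
open Literature.Probability.LatticeModels Literature.MathematicalPhysics.QuantumLattice
open Literature.MathematicalPhysics.QuantumFieldTheory

namespace Summit.QuantumFields.YangMills.Theorems.FreeEnergyLogCoefficient

namespace OneBoxBounds

open ChatterjeeJointLimit WilsonWeakCoupling LatticeMaxwell ChatterjeeAssembly AxialGauge

variable {d : ℕ} (B : OneBoxBounds d)

/-! ### The cubic error of Lemma 17.2 along `m ≤ β^a` -/

/-- `S̄(β) → 0` as `β → ∞`. [folklore] -/
theorem tendsto_Sbar (C : ℝ) : Tendsto (Sbar d C) atTop (𝓝 0) := by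
  have h := (tendsto_rpow_neg_atTop (by norm_num : (0 : ℝ) < 2 / 3)).mul (tendsto_Vf (d := d) C)
  rw [zero_mul] at h
  refine h.congr' ?_
  filter_upwards [eventually_gt_atTop 0] with β hβ
  rw [Sbar_eq hβ]

/-- `ρ₀(m, β) ≤ r₁/2` once `S̄(β) ≤ (r₁/2)²` (for `m ≤ β^a`, `β ≥ 1`). [cite: arXiv160201222, Lemma 17.2] -/
theorem rho0_le_half_r₁ {β : ℝ} (hβ : 1 ≤ β) {m : ℕ} (hm : (m : ℝ) ≤ β ^ aU d)
    (hS : Sbar d B.C71 β ≤ (B.r₁ / 2) ^ 2) : rho0 B.C71 d m β ≤ B.r₁ / 2 := by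
  have h1 := (rho0_sq_le (d := d) B.C71_pos hβ hm).trans hS
  have hr := B.r₁_pos
  exact (pow_le_pow_iff_left₀ (rho0_nonneg B.C71 d m β) (by positivity) two_ne_zero).1 h1

/-- **The cubic error of Lemma 17.2 is small**: `(Aβ(2ρ₀)³d²)² ≤ 64A²d⁴·V(β)³` for
`m ≤ β^a`, `β ≥ 1`. [cite: arXiv160201222, Lemma 17.4 (proof, `βδ³ → 0`)] -/
theorem errU_sq_le {β : ℝ} (hβ : 1 ≤ β) {m : ℕ} (hm : (m : ℝ) ≤ β ^ aU d) :
    (B.A * β * (2 * rho0 B.C71 d m β) ^ 3 * ((d : ℝ) * d)) ^ 2 ≤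
      64 * B.A ^ 2 * (d : ℝ) ^ 4 * (max (Vf d B.C71 β) 0) ^ 3 := by
  have hβ0 : 0 < β := by linarith
  have h1 := rho0_sq_le (d := d) B.C71_pos hβ hm
  rw [Sbar_eq hβ0] at h1
  set V := Vf d B.C71 β with hV
  set ρ := rho0 B.C71 d m β with hρ
  have hρ0 : 0 ≤ ρ := rho0_nonneg B.C71 d m β
  have hb0 : 0 ≤ β ^ (-(2 / 3 : ℝ)) := Real.rpow_nonneg hβ0.le _
  have h2 : ρ ^ 2 ≤ β ^ (-(2 / 3 : ℝ)) * max V 0 :=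
    h1.trans (mul_le_mul_of_nonneg_left (le_max_left _ _) hb0)
  have hM0 : 0 ≤ max V 0 := le_max_right _ _
  have h3 : (ρ ^ 2) ^ 3 ≤ (β ^ (-(2 / 3 : ℝ)) * max V 0) ^ 3 := pow_le_pow_left₀ (sq_nonneg _) h2 3
  have hβpow : (β ^ (-(2 / 3 : ℝ))) ^ 3 = (β ^ 2)⁻¹ := by
    rw [← Real.rpow_natCast, ← Real.rpow_mul hβ0.le]; norm_num
    rfl
  rw [mul_pow, hβpow] at h3
  have hβ2 : 0 < β ^ 2 := by positivity
  have key : β ^ 2 * ρ ^ 6 ≤ (max V 0) ^ 3 := by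
    rw [show ρ ^ 6 = (ρ ^ 2) ^ 3 by ring]
    calc β ^ 2 * (ρ ^ 2) ^ 3 ≤ β ^ 2 * ((β ^ 2)⁻¹ * max V 0 ^ 3) := by gcongr
      _ = (max V 0) ^ 3 := by field_simp
  have hA2 : (0 : ℝ) ≤ B.A ^ 2 := sq_nonneg _
  have hd0 : (0 : ℝ) ≤ (d : ℝ) ^ 4 := by positivity
  calc (B.A * β * (2 * ρ) ^ 3 * ((d : ℝ) * d)) ^ 2
      = 64 * B.A ^ 2 * (d : ℝ) ^ 4 * (β ^ 2 * ρ ^ 6) := by ring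
    _ ≤ 64 * B.A ^ 2 * (d : ℝ) ^ 4 * (max V 0) ^ 3 := by gcongr

/-! ### Lemma 17.4: the upper bound for the joint limit -/

/-- `K ≥ 0`. [folklore] -/
theorem Kc_nonneg : 0 ≤ B.Kc := by
  unfold OneBoxBounds.Kc; have := B.C71_pos; positivity

/-- `K₂ ≥ 0`. [folklore] -/
theorem K₂_nonneg : 0 ≤ B.K₂ := by
  unfold OneBoxBounds.K₂; have := B.Kc_nonneg; positivity

/-- **Lemma 17.3 ⇒ comparison of the normalised free energies**: for `β ≥ 2`, `1 ≤ m < n` and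
`w ≥ max(m/n, 1/m)`, `T(B_n, β) ≤ T(B_m, β) + K₂ w log β`. [cite: arXiv160201222, Lemma 17.4 (proof)] -/
theorem T_le_T_add (hd : 1 ≤ d) {β : ℝ} (hβ2 : 2 ≤ β) {m n : ℕ} (hm1 : 1 ≤ m) (hmn : m + 1 ≤ n)
    {w : ℝ} (hmn_w : (m : ℝ) / n ≤ w) (hm_w : 1 / (m : ℝ) ≤ w) :
    B.T n β ≤ B.T m β + B.K₂ * (w * Real.log β) := by
  have hβ0 : 0 < β := by linarith
  have hL0 : 0 ≤ Real.log β := Real.log_nonneg (by linarith)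
  have hmn' : m ≤ n := by omega
  have hm0 : (0 : ℝ) < m := by exact_mod_cast hm1
  have hw0 : 0 ≤ w := le_trans (by positivity) hm_w
  have hF := B.F_le_mul_F hβ0.le hm1 hmn
  set θ : ℝ := ((((n / (m + 1) : ℕ)) : ℝ) * m / n) ^ d with hθ
  obtain ⟨hθ0', hθ1'⟩ := theta_mem (m := m) (n := n) hmn
  have hθ0 : 0 ≤ θ := pow_nonneg hθ0' d
  have hθ1 : θ ≤ 1 := pow_le_one₀ hθ0' hθ1'
  have h1θ := one_sub_theta_pow_le (d := d) (m := m) (n := n) hmn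
  have hθT := theta_mul_le (x := B.T m β) hθ1
  have hKT := B.abs_T_le hβ2 m
  have hcoef := abs_coef_sub_le (d := d) hd hm1 hmn'
  have hcoefm := coef_le (d := d) m
  have hcm0 := coef_nonneg (d := d) m
  have hw2 : 1 / ((m : ℝ) + 1) ≤ w :=
    le_trans (div_le_div_of_nonneg_left zero_le_one hm0 (by linarith)) hm_w
  have h1θ' : 1 - θ ≤ 2 * d * w := by
    calc 1 - θ ≤ d * ((m : ℝ) / n + 1 / ((m : ℝ) + 1)) := h1θ
      _ ≤ d * (w + w) := by gcongr
      _ = 2 * d * w := by ring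
  have hcoef' : coef d n - θ * coef d m ≤ ((d : ℝ) + 1) * w + 2 * (d : ℝ) ^ 2 * w := by
    have e1 : coef d n - coef d m ≤ ((d : ℝ) + 1) * w := by
      calc coef d n - coef d m ≤ |coef d n - coef d m| := le_abs_self _
        _ ≤ ((d : ℝ) + 1) / m := hcoef
        _ = ((d : ℝ) + 1) * (1 / m) := by ring
        _ ≤ ((d : ℝ) + 1) * w := by gcongr
    have e2 : (1 - θ) * coef d m ≤ 2 * d * w * d := by
      calc (1 - θ) * coef d m ≤ (2 * d * w) * coef d m := by gcongr
        _ ≤ (2 * d * w) * d := by gcongr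
    nlinarith
  have hN2 : (0 : ℝ) ≤ (B.D : ℝ) := Nat.cast_nonneg _
  have hK0 := B.Kc_nonneg
  -- `T n ≤ θ T m + (coef n - θ coef m)/2 D log β`
  have hTn : B.T n β ≤ θ * B.T m β + (coef d n - θ * coef d m) / 2 * (B.D : ℝ) * Real.log β := by
    have e : B.T n β = B.F n β + coef d n / 2 * (B.D : ℝ) * Real.log β := rfl
    have e' : B.T m β = B.F m β + coef d m / 2 * (B.D : ℝ) * Real.log β := rfl
    rw [e, e']
    linarith
  have p1 : (1 - θ) * |B.T m β| ≤ (2 * d * w) * (B.Kc * Real.log β) :=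
    mul_le_mul h1θ' hKT (abs_nonneg _) (by positivity)
  have p2 : (coef d n - θ * coef d m) / 2 * (B.D : ℝ) * Real.log β ≤
      (((d : ℝ) + 1) * w + 2 * (d : ℝ) ^ 2 * w) / 2 * (B.D : ℝ) * Real.log β := by
    gcongr
  have hK2 : B.K₂ * (w * Real.log β) =
      (2 * d * w) * (B.Kc * Real.log β) +
        (((d : ℝ) + 1) * w + 2 * (d : ℝ) ^ 2 * w) / 2 * (B.D : ℝ) * Real.log β := by
    unfold OneBoxBounds.K₂; ring
  rw [hK2]
  linarith

/-- **Lemma 17.4 (the upper bound, joint in `n` and `β`)**: if `G(n) → A₀` then for every `ε > 0`,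
eventually as `(n, β) → (∞, ∞)`, `T(B_n, β) ≤ A₀ + ε`. Proof as printed: for `n ≤ β^a` Lemma 17.2
applies directly (`δ_{n,β}, βδ³_{n,β} → 0`); otherwise compare with `F(B_m, β)` by Lemma 17.3 for
`m = min(⌊β^a⌋, ⌊n/β^{a/2}⌋)`, so that `m → ∞`, `(m/n) log β → 0` and `(log β)/m → 0`. [cite: arXiv160201222, Lemma 17.4] -/
theorem eventually_T_le (hd : 2 ≤ d) {A₀ : ℝ} (hG : Tendsto B.Gm atTop (𝓝 A₀))
    {ε : ℝ} (hε : 0 < ε) :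
    ∀ᶠ p : ℕ × ℝ in atTop ×ˢ atTop, B.T p.1 p.2 ≤ A₀ + ε := by
  have hd1 : 1 ≤ d := by omega
  set C := B.C71 with hC
  have hC0 : 0 < C := B.C71_pos
  have hA := B.A_nonneg
  have hr₁ := B.r₁_pos
  set a := aU d with ha
  have ha0 : 0 < a := aU_pos
  -- Step 1: threshold in `m` from `G → A₀` and `log 2/m^d → 0`
  have hev_m : ∀ᶠ m : ℕ in atTop, B.Gm m ≤ A₀ + ε / 4 ∧ Real.log 2 / (m : ℝ) ^ d ≤ ε / 4 := by
    have h1 : ∀ᶠ m : ℕ in atTop, B.Gm m ≤ A₀ + ε / 4 :=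
      (hG.eventually (ge_mem_nhds (by linarith : A₀ < A₀ + ε / 4)))
    have h2 : Tendsto (fun m : ℕ => Real.log 2 / (m : ℝ) ^ d) atTop (𝓝 0) :=
      tendsto_const_nhds.div_atTop ((tendsto_pow_atTop (by omega)).comp tendsto_natCast_atTop_atTop)
    exact h1.and (h2.eventually (ge_mem_nhds (by positivity)))
  obtain ⟨M₀, hM₀⟩ := eventually_atTop.1 hev_m
  set M := max M₀ 1 with hM
  have hMspec : ∀ m, M ≤ m → B.Gm m ≤ A₀ + ε / 4 ∧ Real.log 2 / (m : ℝ) ^ d ≤ ε / 4 :=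
    fun m hm => hM₀ m ((le_max_left _ _).trans hm)
  have hM1 : 1 ≤ M := le_max_right _ _
  -- Step 2: thresholds in `β`
  have hV3 : Tendsto (fun β => 64 * B.A ^ 2 * (d : ℝ) ^ 4 * (max (Vf d C β) 0) ^ 3)
      atTop (𝓝 0) := by
    have h := ((tendsto_Vf (d := d) C).max (tendsto_const_nhds (x := (0 : ℝ)))).pow 3
    simpa using h.const_mul (64 * B.A ^ 2 * (d : ℝ) ^ 4)
  have hJ : Tendsto (fun β => B.K₂ * (2 * Real.log β / β ^ (a / 2))) atTop (𝓝 0) := by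
    have h := ((tendsto_log_div_rpow' (s := a / 2) (by positivity)).const_mul 2).const_mul B.K₂
    simpa [mul_div_assoc] using h
  have hev_β : ∀ᶠ β : ℝ in atTop, 2 ≤ β ∧ Sbar d C β ≤ (B.r₁ / 2) ^ 2 ∧
      64 * B.A ^ 2 * (d : ℝ) ^ 4 * (max (Vf d C β) 0) ^ 3 ≤ (ε / 4) ^ 2 ∧
      (M : ℝ) + 2 ≤ β ^ (a / 2) ∧ B.K₂ * (2 * Real.log β / β ^ (a / 2)) ≤ ε / 4 :=
    (eventually_ge_atTop 2).and (((tendsto_Sbar (d := d) C).eventually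
      (ge_mem_nhds (by positivity))).and
      ((hV3.eventually (ge_mem_nhds (by positivity))).and
      (((tendsto_rpow_atTop (by positivity)).eventually_ge_atTop _).and
      (hJ.eventually (ge_mem_nhds (by positivity))))))
  -- Step 3: the pointwise argument
  refine ((eventually_ge_atTop M).prod_mk hev_β).mono ?_
  rintro ⟨n, β⟩ ⟨hn, hβ2, hS, hE, hscale, hjunk⟩
  dsimp only at hn hβ2 hS hE hscale hjunk ⊢
  have hβ1 : 1 ≤ β := by linarith
  have hβ0 : 0 < β := by linarith
  have hL0 : 0 ≤ Real.log β := Real.log_nonneg hβ1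
  -- Case A as a reusable claim
  have caseA : ∀ m : ℕ, M ≤ m → (m : ℝ) ≤ β ^ a → B.T m β ≤ A₀ + 3 * ε / 4 := by
    intro m hMm hma
    have hm1 : 1 ≤ m := hM1.trans hMm
    have hρ := B.rho0_le_half_r₁ hβ1 hma hS
    have h := B.T_le_G_add hβ2 hm1 hρ
    have hE0 : 0 ≤ B.A * β * (2 * rho0 C d m β) ^ 3 * ((d : ℝ) * d) := by
      have := rho0_nonneg C d m β; positivity
    have hEsq := (B.errU_sq_le hβ1 hma).trans hE
    have hEle := (pow_le_pow_iff_left₀ hE0 (by positivity) two_ne_zero).1 hEsq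
    obtain ⟨hGm, hlogm⟩ := hMspec m hMm
    linarith
  by_cases hcase : (n : ℝ) ≤ β ^ a
  · linarith [caseA n hn hcase]
  · push Not at hcase
    -- the scales `u = β^{a/2}`, `m = min(⌊β^a⌋, ⌊n/u⌋)`
    have hu3 : (3 : ℝ) ≤ β ^ (a / 2) := by
      have : (1 : ℝ) ≤ M := by exact_mod_cast hM1
      linarith
    generalize hu : β ^ (a / 2) = u at hu3 hscale hjunk
    have hu0 : 0 < u := by linarith
    have hu2 : u ^ 2 = β ^ a := by
      rw [← hu, ← Real.rpow_natCast, ← Real.rpow_mul hβ0.le]; congr 1; push_cast; ring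
    have hβa0 : 0 ≤ β ^ a := Real.rpow_nonneg hβ0.le a
    have hn1 : 1 ≤ n := hM1.trans hn
    have hn0 : (0 : ℝ) < n := by exact_mod_cast hn1
    obtain ⟨m, f1, f2, f3⟩ : ∃ m : ℕ, (m : ℝ) ≤ β ^ a ∧ (m : ℝ) ≤ n / u ∧ u - 1 < m := by
      refine ⟨min ⌊β ^ a⌋₊ ⌊(n : ℝ) / u⌋₊, ?_, ?_, ?_⟩
      · exact le_trans (by exact_mod_cast min_le_left _ _) (Nat.floor_le hβa0)
      · exact le_trans (by exact_mod_cast min_le_right _ _) (Nat.floor_le (by positivity))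
      · have h1 : β ^ a - 1 < ⌊β ^ a⌋₊ := by linarith [Nat.lt_floor_add_one (β ^ a)]
        have h2 : (n : ℝ) / u - 1 < ⌊(n : ℝ) / u⌋₊ := by
          linarith [Nat.lt_floor_add_one ((n : ℝ) / u)]
        have hua : u ≤ β ^ a := by rw [← hu2]; nlinarith
        have hnu : u < n / u := by rw [lt_div_iff₀ hu0]; nlinarith
        rcases Nat.le_total ⌊β ^ a⌋₊ ⌊(n : ℝ) / u⌋₊ with hle | hle
        · rw [min_eq_left hle]; linarith
        · rw [min_eq_right hle]; linarith
    have hMm : M ≤ m := by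
      have : (M : ℝ) < m := by linarith
      exact_mod_cast this.le
    have hm1 : 1 ≤ m := hM1.trans hMm
    have hm0 : (0 : ℝ) < m := by exact_mod_cast hm1
    have hmn : m + 1 ≤ n := by
      have : (m : ℝ) < n := by
        calc (m : ℝ) ≤ n / u := f2
          _ < n := by rw [div_lt_iff₀ hu0]; nlinarith
      exact_mod_cast this
    -- `w = 1/(u-1)`
    have hw1 : (m : ℝ) / n ≤ 1 / (u - 1) := by
      rw [div_le_div_iff₀ hn0 (by linarith)]
      rw [le_div_iff₀ hu0] at f2
      nlinarith
    have hw3 : 1 / (m : ℝ) ≤ 1 / (u - 1) :=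
      div_le_div_of_nonneg_left zero_le_one (by linarith) (by linarith)
    have hcmp := B.T_le_T_add hd1 hβ2 hm1 hmn hw1 hw3
    have hTm := caseA m hMm f1
    -- junk ≤ K₂ (2 log β / u) ≤ ε/4
    have hjunk' : B.K₂ * (1 / (u - 1) * Real.log β) ≤ ε / 4 := by
      have hw4 : 1 / (u - 1) ≤ 2 / u := by
        rw [div_le_div_iff₀ (by linarith) hu0]; linarith
      have : 1 / (u - 1) * Real.log β ≤ 2 * Real.log β / u := by
        calc 1 / (u - 1) * Real.log β ≤ (2 / u) * Real.log β := by gcongr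
          _ = 2 * Real.log β / u := by ring
      exact le_trans (mul_le_mul_of_nonneg_left this B.K₂_nonneg) hjunk
    linarith

end OneBoxBounds

end Summit.QuantumFields.YangMills.Theorems.FreeEnergyLogCoefficient

end
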